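import Summits.QuantumFields.GaugeBoot.ClassBWords
import Summits.QuantumFields.GaugeBoot.WordLoop
import HarnessLib

/-!
# Gauge-boot: the `ℤ^d` word loop `wordLoopZd` restricted to a torus is the torus word loop; expectations of based
# word loops converge at infinite-volume limit points

Cell `ym-instrument` (HOME `run/shared/lean/pub/ym-instrument/`), crew (a), seat `ym-instrument-boot-lean-1` (gen 3);
A-plan-11 «BESSEL CAP», the class-LIMIT side of the per-variable boxes (boot-plan ACT-D (T-a)): the certificate variables
of a class-LIMIT file are the limits `∫ W_0(w) dμ` of the torus expectations `⟨W_0(w)⟩_{(ℤ/L)^d}`; this module supplies the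
convergence for EVERY word `w` (the tree had it for rectangles only, `WilsonLoopLimit.tendsto_wilsonExpectation_wilsonLoop`).

HONEST FRAMING (page 1 of every file of this cell): generic lattice-gauge bookkeeping (any compact `G`, continuous `ρ`,
any `d`, any `β`); nothing is certified about any `(G, D, L, β)`; nothing summit-bearing.

## Content (reusing the tree's `ℤ^d` word layer `ClassBWords`: `Step.applyZd`, `stepHolonomyZd`, `wordHolonomyZd`, `wordLoopZd`)

* `wordHolonomyZd_torusLift`: the holonomy of the periodic lift `torusLift L U` along `w` from `x ∈ ℤ^d` is the torus holonomy
  of `U` along `w` from `x mod L`; hence `toTorusObservable L (wordLoopZd ρ x w) = wordLoop ρ (Torus.proj L x) w`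
  (`toTorusObservable_wordLoopZd`).
* `wordLoopZd ρ x w` is a bounded continuous CYLINDER observable (`exists_isCylinder_wordLoopZd`, `continuous_wordLoopZd`,
  tree `abs_wordLoopZd_le_one`).
* `tendsto_wilsonExpectation_wordLoop`: at an infinite-volume limit point `μ` along tori `(ℤ/(L_k+1))^d`
  (`IsInfiniteVolumeLimitAlong ρ β Lk μ`), `⟨W_{x mod (L_k+1)}(w)⟩_{β} → ∫ W_x(w) dμ` for every word `w` and base point `x`;
  `tendsto_wilsonExpectation_wordLoop_zero` is the based-at-the-origin form used by the certificate families
  (`Rung0D4.W β L w = ⟨W_0(w)⟩`).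
-/

noncomputable section

open MeasureTheory Filter Topology
open Literature.MathematicalPhysics.QuantumFieldTheory
open Literature.MathematicalPhysics.QuantumLattice (LGConfig torusLift torusEdge toTorusObservable IsCylinder
  IsInfiniteVolumeLimitAlong)
open Literature.Probability.LatticeModels (Torus.proj)

namespace Summit.QuantumFields.GaugeBoot

variable {d N : ℕ} {G : Type*} [Group G]

/-! ## Periodic lift: `ℤ^d` word holonomies over a torus configuration -/

/-- Reduction mod `L` commutes with a lattice step. [folklore] -/
theorem torusProj_applyZd (L : ℕ) (x : Literature.Probability.LatticeModels.Site d) (s : Step d) :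
    Torus.proj L (s.applyZd x) = s.apply (Torus.proj L x) := by
  cases s with
  | fwd μ =>
    rw [Step.applyZd_fwd, Step.apply_fwd, Site.shift,
      Literature.MathematicalPhysics.QuantumLattice.torusProj_add_single, Int.cast_one]
  | bwd μ =>
    rw [Step.applyZd_bwd, Step.apply_bwd, sub_eq_add_neg, ← Pi.single_neg,
      Literature.MathematicalPhysics.QuantumLattice.torusProj_add_single, Int.cast_neg, Int.cast_one, Pi.single_neg,
      ← sub_eq_add_neg]

/-- One step of the periodic lift reads the torus link below. [folklore] -/
theorem stepHolonomyZd_torusLift (L : ℕ) (U : GaugeConfig d L G) (x : Literature.Probability.LatticeModels.Site d) (s : Step d) :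
    stepHolonomyZd (torusLift L U) x s = stepHolonomy U (Torus.proj L x) s := by
  cases s with
  | fwd μ => rfl
  | bwd μ =>
    rw [stepHolonomyZd_bwd, stepHolonomy_bwd]
    have h : Torus.proj L (x - Pi.single μ 1) = Torus.proj L x - Pi.single μ 1 := by
      simpa using torusProj_applyZd L x (Step.bwd μ)
    show (U (Torus.proj L (x - Pi.single μ 1), μ))⁻¹ = _
    rw [h]

/-- **The holonomy of the periodic lift along a word is the torus holonomy below it.** [folklore] -/
theorem wordHolonomyZd_torusLift (L : ℕ) (U : GaugeConfig d L G) :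
    ∀ (x : Literature.Probability.LatticeModels.Site d) (w : Word d),
      wordHolonomyZd (torusLift L U) x w = wordHolonomy U (Torus.proj L x) w
  | x, [] => by simp
  | x, s :: w => by
    rw [wordHolonomyZd_cons, wordHolonomy_cons, stepHolonomyZd_torusLift, wordHolonomyZd_torusLift L U (s.applyZd x) w,
      torusProj_applyZd]

/-- **`wordLoopZd` restricted to the torus is the torus word loop**: `toTorusObservable L (W_x(w)) = W_{x mod L}(w)`.
[folklore] -/
theorem toTorusObservable_wordLoopZd (ρ : G →* Matrix (Fin N) (Fin N) ℂ) (L : ℕ)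
    (x : Literature.Probability.LatticeModels.Site d) (w : Word d) :
    toTorusObservable L (wordLoopZd ρ x w) = wordLoop (G := G) ρ (Torus.proj L x) w := by
  funext U
  simp only [Literature.MathematicalPhysics.QuantumLattice.toTorusObservable_apply, wordLoopZd_apply, wordLoop_apply,
    wordHolonomyZd_torusLift]

/-! ## `wordLoopZd` is a bounded continuous cylinder observable -/

/-- Word holonomies on `ℤ^d` depend only on finitely many links. [folklore] -/
theorem exists_dependsOn_wordHolonomyZd :
    ∀ (x : Literature.Probability.LatticeModels.Site d) (w : Word d),
      ∃ S : Finset (Literature.MathematicalPhysics.QuantumLattice.ZdEdge d),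
      ∀ U V : LGConfig d G, (∀ e ∈ S, U e = V e) → wordHolonomyZd U x w = wordHolonomyZd V x w
  | x, [] => ⟨∅, fun U V _ => by simp⟩
  | x, s :: w => by
    classical
    obtain ⟨S, hS⟩ := exists_dependsOn_wordHolonomyZd (s.applyZd x) w
    refine ⟨insert (s.edgeZd x) S, fun U V hUV => ?_⟩
    have h1 : U (s.edgeZd x) = V (s.edgeZd x) := hUV _ (Finset.mem_insert_self _ _)
    have h2 : wordHolonomyZd U (s.applyZd x) w = wordHolonomyZd V (s.applyZd x) w :=
      hS U V fun e he => hUV e (Finset.mem_insert_of_mem he)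
    rw [wordHolonomyZd_cons, wordHolonomyZd_cons, h2]
    cases s with
    | fwd μ => rw [stepHolonomyZd_fwd, stepHolonomyZd_fwd]; exact congrArg (· * _) (by simpa using h1)
    | bwd μ => rw [stepHolonomyZd_bwd, stepHolonomyZd_bwd]; exact congrArg (· * _) (by simpa using congrArg (·⁻¹) h1)

/-- **`W_x(w)` is a cylinder observable.** [folklore] -/
theorem exists_isCylinder_wordLoopZd (ρ : G →* Matrix (Fin N) (Fin N) ℂ) (x : Literature.Probability.LatticeModels.Site d)
    (w : Word d) :
    ∃ S : Finset (Literature.MathematicalPhysics.QuantumLattice.ZdEdge d), IsCylinder (wordLoopZd (G := G) ρ x w) S := by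
  obtain ⟨S, hS⟩ := exists_dependsOn_wordHolonomyZd (G := G) x w
  refine ⟨S, fun U V hUV => ?_⟩
  simp only [wordLoopZd_apply, hS U V hUV]

section Continuity

variable [TopologicalSpace G] [IsTopologicalGroup G]

/-- Continuity of one `ℤ^d` step holonomy in the configuration. [folklore] -/
theorem continuous_stepHolonomyZd (x : Literature.Probability.LatticeModels.Site d) (s : Step d) :
    Continuous fun U : LGConfig d G => stepHolonomyZd U x s := by
  cases s with
  | fwd μ =>
    show Continuous fun U : LGConfig d G => U (x, μ)
    exact continuous_apply _
  | bwd μ =>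
    show Continuous fun U : LGConfig d G => (U (x - Pi.single μ 1, μ))⁻¹
    exact (continuous_apply _).inv

/-- Continuity of `ℤ^d` word holonomies in the configuration (product topology). [folklore] -/
theorem continuous_wordHolonomyZd : ∀ (x : Literature.Probability.LatticeModels.Site d) (w : Word d),
    Continuous fun U : LGConfig d G => wordHolonomyZd U x w
  | x, [] => by simpa using continuous_const
  | x, s :: w => by
    simp only [wordHolonomyZd_cons]
    exact (continuous_stepHolonomyZd x s).mul (continuous_wordHolonomyZd (s.applyZd x) w)

/-- **`W_x(w)` is continuous** for a continuous representation `ρ`. [folklore] -/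
theorem continuous_wordLoopZd {ρ : G →* Matrix (Fin N) (Fin N) ℂ} (hρ : Continuous ρ)
    (x : Literature.Probability.LatticeModels.Site d) (w : Word d) :
    Continuous (wordLoopZd (G := G) ρ x w) := by
  have h : wordLoopZd (G := G) ρ x w = fun U => (N : ℝ)⁻¹ * (ρ (wordHolonomyZd U x w)).trace.re :=
    funext fun U => wordLoopZd_apply ρ x w U
  rw [h]
  exact continuous_const.mul (Complex.continuous_re.comp ((hρ.comp (continuous_wordHolonomyZd x w)).matrix_trace))

end Continuity

/-! ## Convergence of based word-loop expectations at infinite-volume limit points -/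

section Limit

variable [TopologicalSpace G] [IsTopologicalGroup G] [CompactSpace G] [MeasurableSpace G] [BorelSpace G]
  (ρ : G →* Matrix (Fin N) (Fin N) ℂ)

/-- **Word-loop expectations converge at a limit point**: if `μ` is an infinite-volume limit of the torus Wilson states
along `(ℤ/(L_k+1))^d` at coupling `β` (`IsInfiniteVolumeLimitAlong ρ β Lk μ`), then for every word `w` and base point
`x ∈ ℤ^d`, `⟨W_{x mod (L_k+1)}(w)⟩_β → ∫ W_x(w) dμ`. [folklore] -/
theorem tendsto_wilsonExpectation_wordLoop (hρ : Continuous ρ) {β : ℝ} {Lk : ℕ → ℕ} {μ : Measure (LGConfig d G)}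
    (hμ : IsInfiniteVolumeLimitAlong ρ β Lk μ) (x : Literature.Probability.LatticeModels.Site d) (w : Word d) :
    Tendsto (fun k => wilsonExpectation ρ β (wordLoop ρ (Torus.proj (Lk k + 1) x) w)) atTop
      (𝓝 (∫ U, wordLoopZd ρ x w U ∂μ)) := by
  obtain ⟨S, hS⟩ := exists_isCylinder_wordLoopZd (G := G) ρ x w
  have h := hμ.2 _ S hS (continuous_wordLoopZd hρ x w) ⟨1, fun U => abs_wordLoopZd_le_one ρ hρ x w U⟩
  simp only [toTorusObservable_wordLoopZd] at h
  exact h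

/-- The origin of `ℤ^d` projects to the origin of every torus. [folklore] -/
theorem torusProj_zero' (L : ℕ) : Torus.proj L (0 : Literature.Probability.LatticeModels.Site d) = 0 := by
  funext i; simp [Torus.proj]

/-- **Based-at-the-origin form**: `⟨W_0(w)⟩_{(ℤ/(L_k+1))^d, β} → ∫ W_0(w) dμ` for every word `w`. [folklore] -/
theorem tendsto_wilsonExpectation_wordLoop_zero (hρ : Continuous ρ) {β : ℝ} {Lk : ℕ → ℕ} {μ : Measure (LGConfig d G)}
    (hμ : IsInfiniteVolumeLimitAlong ρ β Lk μ) (w : Word d) :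
    Tendsto (fun k => wilsonExpectation ρ β (wordLoop ρ (0 : Site d (Lk k + 1)) w)) atTop
      (𝓝 (∫ U, wordLoopZd ρ (0 : Literature.Probability.LatticeModels.Site d) w U ∂μ)) := by
  have h := tendsto_wilsonExpectation_wordLoop ρ hρ hμ 0 w
  simp only [torusProj_zero'] at h
  exact h

/-- **Closed bounds pass to the limit**: if `|⟨W_0(w)⟩_{(ℤ/(L_k+1))^d, β}| ≤ b` for all large `k`, then
`|∫ W_0(w) dμ| ≤ b`. [folklore] -/
theorem abs_integral_wordLoopZd_le_of_eventually (hρ : Continuous ρ) {β b : ℝ} {Lk : ℕ → ℕ}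
    {μ : Measure (LGConfig d G)} (hμ : IsInfiniteVolumeLimitAlong ρ β Lk μ) (w : Word d)
    (h : ∀ᶠ k in atTop, |wilsonExpectation ρ β (wordLoop ρ (0 : Site d (Lk k + 1)) w)| ≤ b) :
    |∫ U, wordLoopZd ρ (0 : Literature.Probability.LatticeModels.Site d) w U ∂μ| ≤ b := by
  have hlim := tendsto_wilsonExpectation_wordLoop_zero ρ hρ hμ w
  rw [abs_le]
  exact ⟨ge_of_tendsto hlim (h.mono fun k hk => (abs_le.1 hk).1), le_of_tendsto hlim (h.mono fun k hk => (abs_le.1 hk).2)⟩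

end Limit

end Summit.QuantumFields.GaugeBoot

end
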